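import Literature.Combinatorics.SetFamily.BiasedMeasure
import Literature.Combinatorics.SetFamily.BiasedMeasureHetero
import HarnessLib

/-!
# Route NegLimited — R7-A `HeteroDomination` (line `r7-crosscut`, rung F-N1/p3, ROUND-7/8)

Registered stub `stub_heteroDomination` of the skeleton of item T5 =
`NegLimited.GapPerfectMatchingQuasipoly` (stmt-PneNP-19861; cell record HOME/pnp-ideate-p3/ROUND-7.md
§§3–5, `Skeleton-R7-crosscut.lean`): an up-closed event is at least as likely under any product
measure whose coordinate biases all dominate `p` as under the homogeneous `p`-biased measure `μ_p`.

The statement `HeteroDomination` is the planner's (`Sketch-R7.lean` / `turnkey-R8/NegLimitedGapPMDefs.lean`)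
token-for-token; its product weight `prodWeight q W = ∏ₐ (a ∈ W ? q a : 1 - q a)` is the tree's
`Literature.Combinatorics.SetFamily.prodWeight` (`BiasedMeasureHetero.lean`, same body), and the proof
is the Literature lemma `sum_biasedWeight_le_sum_prodWeight_of_upClosed` (heterogeneous monotone
coupling: write `μ_q` as the union of a `μ_p`-random set and an independent coordinatewise top-up;
Grimmett, *Percolation* (1999), §2.1 Thm. (2.1) for the product measures `P_p`, `p = (p(e))`, of §1.3).
No new definition besides the registered statement; nothing is asserted without proof.
-/

set_option linter.dupNamespace false -- `Summit.PneNP.PneNP.…`: summit = sub-problem name (D-0017 single-conjunct layout)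

namespace Summit.PneNP.PneNP.Theorems.NegLimitedGapPM

open Finset
open Literature.Combinatorics.SetFamily (biasedWeight prodWeight)

/-- R7-A: an up-closed event is at least as likely under any product measure whose coordinate
biases dominate `p` as under `μ_p` (heterogeneous `sum_biasedWeight_mono_of_monotone`). -/
def HeteroDomination : Prop :=
  ∀ (α : Type) [Fintype α] [DecidableEq α] (p : ℝ) (q : α → ℝ),
    0 ≤ p → (∀ a, p ≤ q a) → (∀ a, q a ≤ 1) →
    ∀ E : Finset (Finset α), (∀ W ∈ E, ∀ U : Finset α, W ⊆ U → U ∈ E) →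
      ∑ W ∈ E, biasedWeight p W ≤ ∑ W ∈ E, prodWeight q W

/-- **R7-A PROVED** (registered stub `stub_heteroDomination`, by name): the heterogeneous monotone
coupling, from `Literature.Combinatorics.SetFamily.sum_biasedWeight_le_sum_prodWeight_of_upClosed`. -/
theorem stub_heteroDomination : HeteroDomination :=
  fun _α _ _ _p _q hp0 hpq hq1 E hE =>
    Literature.Combinatorics.SetFamily.sum_biasedWeight_le_sum_prodWeight_of_upClosed hp0 hpq hq1 E hE

/-- The same fact under its descriptive name (for files that prefer not to cite a stub name). -/
theorem heteroDomination_holds : HeteroDomination := stub_heteroDomination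

end Summit.PneNP.PneNP.Theorems.NegLimitedGapPM
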